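import Summits.HodgeConjecture.HodgeConjecture.Theorems.F0P3bU2XiSphericalVector      -- part 1∕2 (this seat): `twist_borel_apply_eq`, `exists_compact_open_iwasawa_two`, `exists_xiSpherical`
import Literature.NumberTheory.Automorphic.UnitaryGroupTorusOrbitalDescentNonsplitTwo  -- ★ unimodularity inputs (`modularCharacter_local_eq_one_of_isotropic`, `isMulRightInvariant_of_modularCharacterFun_eq_one`)
import Summits.HodgeConjecture.HodgeConjecture.Theorems.F0P3bHPrincipalSeriesJHOfUTwo   -- ★ p842330: `isOpen_ker_of_continuous_unitsComplex`
import Literature.NumberTheory.Automorphic.CMPrincipalSeriesJacquetEvalOne             -- ★ `nonarchimedeanGroup_cmLocal`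
import HarnessLib

/-!
# (H4) — `ξ₂ = (η_v ψ_v) ∘ det` is a QUOTIENT of `i(χH₂)` on `U(Φ₂)(L⁺_v)`: the `ξ₂`-twisted invariant `K_v`-integral

Cell hodgecm-mathlib (FLOOR 0), crux `H413` = `stmt-HodgeConjecture-24833`, line «CMCharIdentityTest» (ED. 11), joint (N-H-ii′) ⟸ (JH₂) ⟸
(H3) + (H4) (+ (EIG) ★) — ★ junction `F0P3bU2PrincipalSeriesJHOfBricks.uTwoPrincipalSeriesJH_of_bricks` (p842461).  THIS FILE (theorems only; no `def`,
no named fact, no `sorry`) PROVES the binder **(H4)** `hQ` VERBATIM — `xi_quotient_functional` (§4): a non-zero linear functional `q` on `i(χH₂)` with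
`q(g·f) = ξ₂(g) q(f)`; after it (JH₂) ⟸ (H3) `hHC` alone (`uTwoPrincipalSeriesJH_of_bricks hHC xi_quotient_functional no_char_eigenvector_cmPrincipalSeries_two`).
* §1–§2 (part 1∕2, `F0P3bU2XiSphericalVector`): the dictionary `τ = ξ₂ · δ_{B₂}` on `B₂`, `K_v` with `G₂ = B₂ · K_v`, the `ξ₂`-spherical vector `f₀`.
* §3 THE FUNCTIONAL `q(f) = ∫_{K_v} Ξ(κ⁻¹) f(κ) dμ_{K_v}` for an abstract continuous character `Ξ` of `G₂` with open kernel agreeing with `ξ₂`: `q(f₀) ≠ 0`,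
  and `q(g·f) = Ξ(g) q(f)` by unfolding `∫_G Ξ(y⁻¹) (1_{K_v} f)(y g) dν(y)` twice (★ `exists_integral_eq_mul_integral_compact_borel` `∫_G = C ∫_K ∫_B`, the
  modular substitution on `B₂`, unimodularity of `G₂` ★ `modularCharacter_local_eq_one_of_isotropic`).
* §4 HEAD `xi_quotient_functional` = (H4) at `Ξ := (η_v ∘ det)(ψ_v ∘ det)` (continuous ★, open kernel since `G₂` is non-archimedean ★).
HONEST LABEL: HC_CM is proved only modulo the 2 remaining named inputs (hLiu418, h413) until rung 0 closes.

## References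
* [Rogawski1990] J. D. Rogawski, *Automorphic Representations of Unitary Groups in Three Variables* (1990), §12.1 case (1) pp. 171–172, §4.5 p. 45.
* [Casselman1995] W. Casselman, *Introduction to the theory of admissible representations of p-adic reductive groups* (1995), §3.1, Prop. 6.4.1.
* [BernsteinZelevinsky1977] I. N. Bernstein, A. V. Zelevinsky, Ann. Sci. ÉNS 10 (1977), §2.3 (the functors `i_{G,M}`, `r_{M,G}`).
* [BernsteinZelevinsky1976] I. N. Bernšteĭn, A. V. Zelevinskiĭ, Russian Math. Surveys 31:3 (1976), Prop. 2.29 pp. 23–24 (Frobenius reciprocity with the modulus `Δ_H∕Δ_G`; Thm. 2.28).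
* [CartierCorvallis1979] P. Cartier, *Representations of p-adic groups: a survey*, PSPM 33.1 (1979), §III.3–§IV.1.
-/

set_option autoImplicit false
set_option linter.dupNamespace false

noncomputable section

open NumberField IsDedekindDomain MeasureTheory
open scoped Matrix MatrixGroups NNReal
open Literature.NumberTheory.Rogawski1990 Literature.NumberTheory.Automorphic Literature.NumberTheory.Automorphic.UnitaryGroup
open Literature.NumberTheory.GaloisRepresentations


namespace Summit.HodgeConjecture.HodgeConjecture.Cruxes.H413.F0P3bU2XiQuotientFunctional

open Summit.HodgeConjecture.HodgeConjecture.Cruxes.H413.F0P3bU2XiSphericalVector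

variable (L : Type) [Field L] [NumberField L] [IsCMField L] (v : HeightOneSpectrum (𝓞 ↥(maximalRealSubfield L)))

/-! ## §3 The functional `q(f) = ∫_{K_v} Ξ(κ)⁻¹ f(κ) dκ`: non-zero and `(G, Ξ)`-equivariant -/

set_option synthInstance.maxHeartbeats 400000 in
set_option maxHeartbeats 40000000 in  -- measured: the `G = B·K` formula instantiation + the CM carriers cost ≈ 7·10⁶ alone (wall ≈ 1 min); 6·10⁶ fails
/-- **THE `Ξ`-QUOTIENT OF `i(χH₂)`** for an abstract character `Ξ` of `G₂` agreeing with `(η_v ψ_v) ∘ det` (continuous, open kernel): there is a linear functional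
`q` on `i(χH₂)` with `q ≠ 0` and `q(g·f) = Ξ(g) q(f)`.  `q(f) := ∫_{K_v} Ξ(κ⁻¹) f(κ) dμ_{K_v}` (`K_v = cmLocalIntegralLevel`); `q(f₀) = μ(K_v) ≠ 0` on the `Ξ`-spherical
vector (§2); equivariance: with `φ_f := 1_{K_v} · f` one has `∫_{B₂} Ξ(b⁻¹) φ_f(b x) db = μ_{B₂}(B₂ ∩ K_v) · f(x)` for ALL `x` (Iwasawa, the modular substitution
`∫ H(b b₁) db = δ_{B₂}(b₁) ∫ H db`, §1 dictionary `τ = Ξ · δ_{B₂}` on `B₂`, `δ_{B₂} = 1` on `B₂ ∩ K_v`), hence `∫_G Ξ(y⁻¹) φ_f(y g) dν = C · μ_{B₂}(B₂ ∩ K_v) · q(g·f)` (★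
`exists_integral_eq_mul_integral_compact_borel`), while the left side is `Ξ(g) ∫_G Ξ(y⁻¹) φ_f(y) dν` (`G₂` unimodular ★, right translation).
[cite: Rogawski1990, §12.1 case (1) pp. 171–172] [cite: Casselman1995, §3.1, Prop. 6.4.1] [cite: BernsteinZelevinsky1977, §2.3] [cite: BernsteinZelevinsky1976, Prop. 2.29 pp. 23–24] -/
theorem exists_xiQuotient_of_char (ξ : OneDimAutRepH L)
    (Ξ : ↥(unitaryGroupOfForm (conjLocal L (IsCMField.complexConj L) v) (cmLocalForm L 2 v)) →* ℂˣ)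
    (hΞ : ∀ g, Ξ g = torusLocalComponent L (IsCMField.complexConj L) v ξ.η (localDet (IsCMField.complexConj L) v (isUnit_antidiagOne_det L 2) g) *
      torusLocalComponent L (IsCMField.complexConj L) v ξ.ψ (localDet (IsCMField.complexConj L) v (isUnit_antidiagOne_det L 2) g))
    (hΞc : Continuous fun g => ((Ξ g : ℂˣ) : ℂ))
    (hΞo : IsOpen ((Ξ.ker : Subgroup _) : Set ↥(unitaryGroupOfForm (conjLocal L (IsCMField.complexConj L) v) (cmLocalForm L 2 v)))) :
    haveI := locallyCompactSpace_cmBorelU L 2 v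
    ∃ q : Representation.SmoothInd (cmBorelTriple L 2 v).P
        (Representation.twist
          (((Representation.trivial ℂ ↥(torusU (conjLocal L (IsCMField.complexConj L) v) (cmLocalForm L 2 v)) ℂ).twist
            (torusCharPair (conjLocal L (IsCMField.complexConj L) v) (cmLocalForm L 2 v) (cmLocalForm_eq_over L 2 v) 0
              ((torusLocalComponent L (IsCMField.complexConj L) v ξ.η).comp
                  (quotConj (conjLocal L (IsCMField.complexConj L) v) (conjLocal_conjLocal_cm L v)) *
                halfModulusChar (UnitaryGroup.LocalRing L v))
              (torusLocalComponent L (IsCMField.complexConj L) v ξ.ψ))).comp (cmBorelTriple L 2 v).proj)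
          (rootDeltaChar (cmBorelTriple L 2 v).P)) →ₗ[ℂ] ℂ,
      (∃ f, q f ≠ 0) ∧
      ∀ (g : ↥(unitaryGroupOfForm (conjLocal L (IsCMField.complexConj L) v) (cmLocalForm L 2 v))) (f : _), q (cmPrincipalSeries L 2 v (torusCharPair (conjLocal L (IsCMField.complexConj L) v) (cmLocalForm L 2 v) (cmLocalForm_eq_over L 2 v) 0
                ((torusLocalComponent L (IsCMField.complexConj L) v ξ.η).comp
                    (quotConj (conjLocal L (IsCMField.complexConj L) v) (conjLocal_conjLocal_cm L v)) *
                  halfModulusChar (UnitaryGroup.LocalRing L v))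
                (torusLocalComponent L (IsCMField.complexConj L) v ξ.ψ)) g f) = ((Ξ g : ℂˣ) : ℂ) * q f := by
  haveI := locallyCompactSpace_cmBorelU L 2 v
  classical
  -- topology and measures
  haveI : LocallyCompactSpace ↥(unitaryGroupOfForm (conjLocal L (IsCMField.complexConj L) v) (cmLocalForm L 2 v)) := locallyCompactSpace_local (IsCMField.complexConj L) 2 _ v
  haveI : SecondCountableTopology ↥(unitaryGroupOfForm (conjLocal L (IsCMField.complexConj L) v) (cmLocalForm L 2 v)) := secondCountableTopology_local (IsCMField.complexConj L) 2 _ v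
  letI : MeasurableSpace ↥(unitaryGroupOfForm (conjLocal L (IsCMField.complexConj L) v) (cmLocalForm L 2 v)) := borel _
  haveI : BorelSpace ↥(unitaryGroupOfForm (conjLocal L (IsCMField.complexConj L) v) (cmLocalForm L 2 v)) := ⟨rfl⟩
  obtain ⟨KU, hKc, hKo, hGK⟩ := exists_compact_open_iwasawa_two L v
  have hKcl : IsClosed (KU : Set ↥(unitaryGroupOfForm (conjLocal L (IsCMField.complexConj L) v) (cmLocalForm L 2 v))) := hKc.isClosed
  -- instances on `↥K` given EXPLICITLY (typeclass search for them through the CM carrier is prohibitively expensive)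
  haveI : CompactSpace ↥KU := isCompact_iff_compactSpace.1 hKc
  haveI : LocallyCompactSpace ↥KU := hKcl.locallyCompactSpace
  haveI : SecondCountableTopology ↥KU := TopologicalSpace.Subtype.secondCountableTopology _
  haveI : T2Space ↥(unitaryGroupOfForm (conjLocal L (IsCMField.complexConj L) v) (cmLocalForm L 2 v)) := t2Space_cmDatum_local 2 L (Matrix.of fun i j : Fin 2 => if i.val + j.val + 1 = 2 then (1 : L) else 0) v
  haveI : T1Space (LocalRing L v) := inferInstance
  have hBcl : IsClosed (((cmBorelTriple L 2 v).P : Subgroup ↥(unitaryGroupOfForm (conjLocal L (IsCMField.complexConj L) v) (cmLocalForm L 2 v))) : Set ↥(unitaryGroupOfForm (conjLocal L (IsCMField.complexConj L) v) (cmLocalForm L 2 v))) := isClosed_borelU _ _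
  haveI : SecondCountableTopology ↥(cmBorelTriple L 2 v).P := TopologicalSpace.Subtype.secondCountableTopology _
  obtain ⟨ν, hνH⟩ : ∃ ν : Measure ↥(unitaryGroupOfForm (conjLocal L (IsCMField.complexConj L) v) (cmLocalForm L 2 v)), ν.IsHaarMeasure := ⟨Measure.haar, inferInstance⟩
  obtain ⟨μB, hμBH⟩ : ∃ μB : Measure ↥(cmBorelTriple L 2 v).P, μB.IsHaarMeasure := ⟨Measure.haar, inferInstance⟩
  obtain ⟨μK, hμKH⟩ : ∃ μK : Measure ↥KU, μK.IsHaarMeasure := ⟨Measure.haar, inferInstance⟩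
  -- `G = B · K_v` integration formula
  obtain ⟨C, hC, hform⟩ := exists_integral_eq_mul_integral_compact_borel L 2 v KU hKc hGK ν μB μK
  -- `δ_{B₂} = 1` on `B₂ ∩ K_v`
  have hδ1 : ∀ c : ↥(cmBorelTriple L 2 v).P, (c : ↥(unitaryGroupOfForm (conjLocal L (IsCMField.complexConj L) v) (cmLocalForm L 2 v))) ∈ KU → deltaChar (cmBorelTriple L 2 v).P c = 1 := fun c hc =>
    deltaChar_eq_one_of_mem_of_isCompact (cmBorelTriple L 2 v).P (C := KU.comap ((cmBorelTriple L 2 v).P).subtype)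
      (hBcl.isClosedEmbedding_subtypeVal.isCompact_preimage hKc) hc
  -- the scalar of the inducing character on `B₂` (§1)
  have hτ : ∀ (b : ↥(cmBorelTriple L 2 v).P) (z : ℂ), (Representation.twist
          (((Representation.trivial ℂ ↥(torusU (conjLocal L (IsCMField.complexConj L) v) (cmLocalForm L 2 v)) ℂ).twist
            (torusCharPair (conjLocal L (IsCMField.complexConj L) v) (cmLocalForm L 2 v) (cmLocalForm_eq_over L 2 v) 0
              ((torusLocalComponent L (IsCMField.complexConj L) v ξ.η).comp
                  (quotConj (conjLocal L (IsCMField.complexConj L) v) (conjLocal_conjLocal_cm L v)) *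
                halfModulusChar (UnitaryGroup.LocalRing L v))
              (torusLocalComponent L (IsCMField.complexConj L) v ξ.ψ))).comp (cmBorelTriple L 2 v).proj)
          (rootDeltaChar (cmBorelTriple L 2 v).P)) b z = ((Ξ b : ℂˣ) : ℂ) * ((deltaChar (cmBorelTriple L 2 v).P b : ℂˣ) : ℂ) * z := by
    intro b z; rw [twist_borel_apply_eq L v ξ b z, ← hΞ]
  -- `φ_f = 1_{K_v} · f` is locally constant
  have hφlc : ∀ f : Representation.SmoothInd (cmBorelTriple L 2 v).P (Representation.twist
          (((Representation.trivial ℂ ↥(torusU (conjLocal L (IsCMField.complexConj L) v) (cmLocalForm L 2 v)) ℂ).twist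
            (torusCharPair (conjLocal L (IsCMField.complexConj L) v) (cmLocalForm L 2 v) (cmLocalForm_eq_over L 2 v) 0
              ((torusLocalComponent L (IsCMField.complexConj L) v ξ.η).comp
                  (quotConj (conjLocal L (IsCMField.complexConj L) v) (conjLocal_conjLocal_cm L v)) *
                halfModulusChar (UnitaryGroup.LocalRing L v))
              (torusLocalComponent L (IsCMField.complexConj L) v ξ.ψ))).comp (cmBorelTriple L 2 v).proj)
          (rootDeltaChar (cmBorelTriple L 2 v).P)),
      IsLocallyConstant ((KU : Set ↥(unitaryGroupOfForm (conjLocal L (IsCMField.complexConj L) v) (cmLocalForm L 2 v))).indicator f.toFun) := by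
    intro f
    rw [IsLocallyConstant.iff_exists_open]
    intro y
    by_cases hy : y ∈ (KU : Set ↥(unitaryGroupOfForm (conjLocal L (IsCMField.complexConj L) v) (cmLocalForm L 2 v)))
    · obtain ⟨U, hU, hyU, hUc⟩ := (IsLocallyConstant.iff_exists_open _).1 (SmoothInd.isLocallyConstant_toFun f) y
      refine ⟨U ∩ (KU : Set ↥(unitaryGroupOfForm (conjLocal L (IsCMField.complexConj L) v) (cmLocalForm L 2 v))), hU.inter hKo, ⟨hyU, hy⟩, fun y' hy' => ?_⟩
      rw [Set.indicator_of_mem hy'.2, Set.indicator_of_mem hy, hUc y' hy'.1]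
    · refine ⟨(KU : Set ↥(unitaryGroupOfForm (conjLocal L (IsCMField.complexConj L) v) (cmLocalForm L 2 v)))ᶜ, hKcl.isOpen_compl, hy, fun y' hy' => ?_⟩
      rw [Set.indicator_of_notMem hy', Set.indicator_of_notMem hy]
  -- integrability on `K_v`
  have hint : ∀ f : Representation.SmoothInd (cmBorelTriple L 2 v).P (Representation.twist
          (((Representation.trivial ℂ ↥(torusU (conjLocal L (IsCMField.complexConj L) v) (cmLocalForm L 2 v)) ℂ).twist
            (torusCharPair (conjLocal L (IsCMField.complexConj L) v) (cmLocalForm L 2 v) (cmLocalForm_eq_over L 2 v) 0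
              ((torusLocalComponent L (IsCMField.complexConj L) v ξ.η).comp
                  (quotConj (conjLocal L (IsCMField.complexConj L) v) (conjLocal_conjLocal_cm L v)) *
                halfModulusChar (UnitaryGroup.LocalRing L v))
              (torusLocalComponent L (IsCMField.complexConj L) v ξ.ψ))).comp (cmBorelTriple L 2 v).proj)
          (rootDeltaChar (cmBorelTriple L 2 v).P)),
      Integrable (fun k : ↥KU => ((Ξ ((k : ↥(unitaryGroupOfForm (conjLocal L (IsCMField.complexConj L) v) (cmLocalForm L 2 v)))⁻¹) : ℂˣ) : ℂ) * f.toFun k) μK := by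
    intro f
    have hc : Continuous fun k : ↥KU => ((Ξ ((k : ↥(unitaryGroupOfForm (conjLocal L (IsCMField.complexConj L) v) (cmLocalForm L 2 v)))⁻¹) : ℂˣ) : ℂ) * f.toFun k :=
      (hΞc.comp continuous_subtype_val.inv).mul ((SmoothInd.isLocallyConstant_toFun f).continuous.comp continuous_subtype_val)
    exact (integrableOn_univ.1 (hc.continuousOn.integrableOn_compact isCompact_univ))
  -- the functional `q(f) = ∫_K Ξ(κ⁻¹) f(κ) dμ_K` (built as an explicit structure; `hq` is its defining formula)
  obtain ⟨q, hq⟩ : ∃ q : Representation.SmoothInd (cmBorelTriple L 2 v).P (Representation.twist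
          (((Representation.trivial ℂ ↥(torusU (conjLocal L (IsCMField.complexConj L) v) (cmLocalForm L 2 v)) ℂ).twist
            (torusCharPair (conjLocal L (IsCMField.complexConj L) v) (cmLocalForm L 2 v) (cmLocalForm_eq_over L 2 v) 0
              ((torusLocalComponent L (IsCMField.complexConj L) v ξ.η).comp
                  (quotConj (conjLocal L (IsCMField.complexConj L) v) (conjLocal_conjLocal_cm L v)) *
                halfModulusChar (UnitaryGroup.LocalRing L v))
              (torusLocalComponent L (IsCMField.complexConj L) v ξ.ψ))).comp (cmBorelTriple L 2 v).proj)
          (rootDeltaChar (cmBorelTriple L 2 v).P)) →ₗ[ℂ] ℂ,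
      ∀ f, q f = ∫ k : ↥KU, ((Ξ ((k : ↥(unitaryGroupOfForm (conjLocal L (IsCMField.complexConj L) v) (cmLocalForm L 2 v)))⁻¹) : ℂˣ) : ℂ) * f.toFun k ∂μK :=
    ⟨{ toFun := fun f => (∫ k : ↥KU, ((Ξ ((k : ↥(unitaryGroupOfForm (conjLocal L (IsCMField.complexConj L) v) (cmLocalForm L 2 v)))⁻¹) : ℂˣ) : ℂ) * f.toFun k ∂μK),
        map_add' := fun f f' => by
          simp only [Representation.SmoothInd.toFun_add, Pi.add_apply, mul_add]
          exact integral_add (hint f) (hint f'),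
        map_smul' := fun c f => by
          simp only [Representation.SmoothInd.toFun_smul, Pi.smul_apply, smul_eq_mul, RingHom.id_apply]
          rw [← integral_const_mul]
          refine integral_congr_ae (Filter.Eventually.of_forall fun k => ?_)
          ring }, fun f => rfl⟩
  -- (P) `∫_B Ξ(b⁻¹) φ_f(b x) db = μ_B(B ∩ K) · f(x)` for every `x`
  obtain ⟨m, hm⟩ : ∃ m : ℝ, m = μB.real (Subtype.val ⁻¹' (KU : Set ↥(unitaryGroupOfForm (conjLocal L (IsCMField.complexConj L) v) (cmLocalForm L 2 v)))) := ⟨_, rfl⟩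
  have hSmeas : MeasurableSet (Subtype.val ⁻¹' (KU : Set ↥(unitaryGroupOfForm (conjLocal L (IsCMField.complexConj L) v) (cmLocalForm L 2 v))) : Set ↥(cmBorelTriple L 2 v).P) :=
    (hKo.preimage continuous_subtype_val).measurableSet
  have hP : ∀ (f : Representation.SmoothInd (cmBorelTriple L 2 v).P (Representation.twist
          (((Representation.trivial ℂ ↥(torusU (conjLocal L (IsCMField.complexConj L) v) (cmLocalForm L 2 v)) ℂ).twist
            (torusCharPair (conjLocal L (IsCMField.complexConj L) v) (cmLocalForm L 2 v) (cmLocalForm_eq_over L 2 v) 0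
              ((torusLocalComponent L (IsCMField.complexConj L) v ξ.η).comp
                  (quotConj (conjLocal L (IsCMField.complexConj L) v) (conjLocal_conjLocal_cm L v)) *
                halfModulusChar (UnitaryGroup.LocalRing L v))
              (torusLocalComponent L (IsCMField.complexConj L) v ξ.ψ))).comp (cmBorelTriple L 2 v).proj)
          (rootDeltaChar (cmBorelTriple L 2 v).P))) (x : ↥(unitaryGroupOfForm (conjLocal L (IsCMField.complexConj L) v) (cmLocalForm L 2 v))),
      ∫ b : ↥(cmBorelTriple L 2 v).P, ((Ξ ((b : ↥(unitaryGroupOfForm (conjLocal L (IsCMField.complexConj L) v) (cmLocalForm L 2 v)))⁻¹) : ℂˣ) : ℂ) * (KU : Set ↥(unitaryGroupOfForm (conjLocal L (IsCMField.complexConj L) v) (cmLocalForm L 2 v))).indicator f.toFun ((b : ↥(unitaryGroupOfForm (conjLocal L (IsCMField.complexConj L) v) (cmLocalForm L 2 v))) * x) ∂μB = (m : ℂ) * f.toFun x := by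
    intro f x
    -- the inner identity on `K_v`
    have hK : ∀ κ : ↥(unitaryGroupOfForm (conjLocal L (IsCMField.complexConj L) v) (cmLocalForm L 2 v)), κ ∈ KU →
        ∫ b : ↥(cmBorelTriple L 2 v).P, ((Ξ ((b : ↥(unitaryGroupOfForm (conjLocal L (IsCMField.complexConj L) v) (cmLocalForm L 2 v)))⁻¹) : ℂˣ) : ℂ) * (KU : Set ↥(unitaryGroupOfForm (conjLocal L (IsCMField.complexConj L) v) (cmLocalForm L 2 v))).indicator f.toFun ((b : ↥(unitaryGroupOfForm (conjLocal L (IsCMField.complexConj L) v) (cmLocalForm L 2 v))) * κ) ∂μB = (m : ℂ) * f.toFun κ := by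
      intro κ hκ
      have hpt : ∀ b : ↥(cmBorelTriple L 2 v).P, ((Ξ ((b : ↥(unitaryGroupOfForm (conjLocal L (IsCMField.complexConj L) v) (cmLocalForm L 2 v)))⁻¹) : ℂˣ) : ℂ) * (KU : Set ↥(unitaryGroupOfForm (conjLocal L (IsCMField.complexConj L) v) (cmLocalForm L 2 v))).indicator f.toFun ((b : ↥(unitaryGroupOfForm (conjLocal L (IsCMField.complexConj L) v) (cmLocalForm L 2 v))) * κ) =
          (Subtype.val ⁻¹' (KU : Set ↥(unitaryGroupOfForm (conjLocal L (IsCMField.complexConj L) v) (cmLocalForm L 2 v))) : Set ↥(cmBorelTriple L 2 v).P).indicator (fun _ => f.toFun κ) b := by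
        intro b
        by_cases hb : (b : ↥(unitaryGroupOfForm (conjLocal L (IsCMField.complexConj L) v) (cmLocalForm L 2 v))) ∈ KU
        · have hbκ : (b : ↥(unitaryGroupOfForm (conjLocal L (IsCMField.complexConj L) v) (cmLocalForm L 2 v))) * κ ∈ (KU : Set ↥(unitaryGroupOfForm (conjLocal L (IsCMField.complexConj L) v) (cmLocalForm L 2 v))) := KU.mul_mem hb hκ
          rw [Set.indicator_of_mem hbκ, Set.indicator_of_mem (show b ∈ Subtype.val ⁻¹' (KU : Set ↥(unitaryGroupOfForm (conjLocal L (IsCMField.complexConj L) v) (cmLocalForm L 2 v))) from hb),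
            Representation.SmoothInd.toFun_subgroup_mul, hτ, hδ1 b hb, Units.val_one, mul_one, ← mul_assoc, ← Units.val_mul, ← map_mul,
            inv_mul_cancel, map_one, Units.val_one, one_mul]
        · have hbκ : (b : ↥(unitaryGroupOfForm (conjLocal L (IsCMField.complexConj L) v) (cmLocalForm L 2 v))) * κ ∉ (KU : Set ↥(unitaryGroupOfForm (conjLocal L (IsCMField.complexConj L) v) (cmLocalForm L 2 v))) := fun h => hb (by
            have := KU.mul_mem h (KU.inv_mem hκ)
            rwa [mul_inv_cancel_right] at this)
          rw [Set.indicator_of_notMem hbκ, Set.indicator_of_notMem (show b ∉ Subtype.val ⁻¹' (KU : Set ↥(unitaryGroupOfForm (conjLocal L (IsCMField.complexConj L) v) (cmLocalForm L 2 v))) from hb), mul_zero]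
      rw [show (fun b : ↥(cmBorelTriple L 2 v).P => ((Ξ ((b : ↥(unitaryGroupOfForm (conjLocal L (IsCMField.complexConj L) v) (cmLocalForm L 2 v)))⁻¹) : ℂˣ) : ℂ) * (KU : Set ↥(unitaryGroupOfForm (conjLocal L (IsCMField.complexConj L) v) (cmLocalForm L 2 v))).indicator f.toFun ((b : ↥(unitaryGroupOfForm (conjLocal L (IsCMField.complexConj L) v) (cmLocalForm L 2 v))) * κ)) =
          (Subtype.val ⁻¹' (KU : Set ↥(unitaryGroupOfForm (conjLocal L (IsCMField.complexConj L) v) (cmLocalForm L 2 v))) : Set ↥(cmBorelTriple L 2 v).P).indicator (fun _ => f.toFun κ) from funext hpt,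
        integral_indicator_const _ hSmeas, hm, Complex.real_smul]
    -- Iwasawa `x = b₁ κ₁` and the modular substitution
    obtain ⟨b₁, κ₁, hκ₁, hx⟩ := hGK x
    have hmap : μB.map (fun b => b * b₁) = Measure.modularCharacterFun b₁ • μB := by
      rw [Measure.modularCharacterFun_eq_haarScalarFactor μB b₁]
      exact Measure.isMulLeftInvariant_eq_smul _ _
    obtain ⟨H, hH⟩ : ∃ H : ↥(cmBorelTriple L 2 v).P → ℂ, ∀ b' : ↥(cmBorelTriple L 2 v).P, H b' = ((Ξ (b₁ : ↥(unitaryGroupOfForm (conjLocal L (IsCMField.complexConj L) v) (cmLocalForm L 2 v))) : ℂˣ) : ℂ) *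
        (((Ξ ((b' : ↥(unitaryGroupOfForm (conjLocal L (IsCMField.complexConj L) v) (cmLocalForm L 2 v)))⁻¹) : ℂˣ) : ℂ) * (KU : Set ↥(unitaryGroupOfForm (conjLocal L (IsCMField.complexConj L) v) (cmLocalForm L 2 v))).indicator f.toFun ((b' : ↥(unitaryGroupOfForm (conjLocal L (IsCMField.complexConj L) v) (cmLocalForm L 2 v))) * κ₁)) := ⟨_, fun _ => rfl⟩
    have hΞinv : ∀ y : ↥(unitaryGroupOfForm (conjLocal L (IsCMField.complexConj L) v) (cmLocalForm L 2 v)), ((Ξ y : ℂˣ) : ℂ) * ((Ξ y⁻¹ : ℂˣ) : ℂ) = 1 := fun y => by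
      rw [← Units.val_mul, ← map_mul, mul_inv_cancel, map_one, Units.val_one]
    have hHeq : ∀ b : ↥(cmBorelTriple L 2 v).P,
        ((Ξ ((b : ↥(unitaryGroupOfForm (conjLocal L (IsCMField.complexConj L) v) (cmLocalForm L 2 v)))⁻¹) : ℂˣ) : ℂ) * (KU : Set ↥(unitaryGroupOfForm (conjLocal L (IsCMField.complexConj L) v) (cmLocalForm L 2 v))).indicator f.toFun ((b : ↥(unitaryGroupOfForm (conjLocal L (IsCMField.complexConj L) v) (cmLocalForm L 2 v))) * x) = H (b * b₁) := by
      intro b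
      rw [hH (b * b₁), hx, Subgroup.coe_mul, mul_inv_rev, map_mul, Units.val_mul, mul_assoc (b : ↥(unitaryGroupOfForm (conjLocal L (IsCMField.complexConj L) v) (cmLocalForm L 2 v))) (b₁ : ↥(unitaryGroupOfForm (conjLocal L (IsCMField.complexConj L) v) (cmLocalForm L 2 v))) κ₁]
      linear_combination (-(((Ξ ((b : ↥(unitaryGroupOfForm (conjLocal L (IsCMField.complexConj L) v) (cmLocalForm L 2 v)))⁻¹) : ℂˣ) : ℂ) * (KU : Set ↥(unitaryGroupOfForm (conjLocal L (IsCMField.complexConj L) v) (cmLocalForm L 2 v))).indicator f.toFun ((b : ↥(unitaryGroupOfForm (conjLocal L (IsCMField.complexConj L) v) (cmLocalForm L 2 v))) * ((b₁ : ↥(unitaryGroupOfForm (conjLocal L (IsCMField.complexConj L) v) (cmLocalForm L 2 v))) * κ₁)))) * hΞinv (b₁ : ↥(unitaryGroupOfForm (conjLocal L (IsCMField.complexConj L) v) (cmLocalForm L 2 v)))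
    have hsub : ∫ b : ↥(cmBorelTriple L 2 v).P, H (b * b₁) ∂μB = (Measure.modularCharacterFun b₁ : ℝ≥0) • ∫ b, H b ∂μB := by
      have e1 : ∫ b : ↥(cmBorelTriple L 2 v).P, H (b * b₁) ∂μB = ∫ b, H b ∂(μB.map (fun b => b * b₁)) := by
        rw [← Homeomorph.coe_mulRight, ← Homeomorph.toMeasurableEquiv_coe, integral_map_equiv]
        simp only [Homeomorph.toMeasurableEquiv_coe, Homeomorph.coe_mulRight]
      rw [e1, hmap, integral_smul_nnreal_measure]
    calc ∫ b : ↥(cmBorelTriple L 2 v).P, ((Ξ ((b : ↥(unitaryGroupOfForm (conjLocal L (IsCMField.complexConj L) v) (cmLocalForm L 2 v)))⁻¹) : ℂˣ) : ℂ) * (KU : Set ↥(unitaryGroupOfForm (conjLocal L (IsCMField.complexConj L) v) (cmLocalForm L 2 v))).indicator f.toFun ((b : ↥(unitaryGroupOfForm (conjLocal L (IsCMField.complexConj L) v) (cmLocalForm L 2 v))) * x) ∂μB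
        = ∫ b : ↥(cmBorelTriple L 2 v).P, H (b * b₁) ∂μB := by exact integral_congr_ae (Filter.Eventually.of_forall hHeq)
      _ = (Measure.modularCharacterFun b₁ : ℝ≥0) • ∫ b, H b ∂μB := hsub
      _ = (Measure.modularCharacterFun b₁ : ℝ≥0) • (((Ξ (b₁ : ↥(unitaryGroupOfForm (conjLocal L (IsCMField.complexConj L) v) (cmLocalForm L 2 v))) : ℂˣ) : ℂ) * ((m : ℂ) * f.toFun κ₁)) := by
          rw [show H = fun b' => _ from funext hH, integral_const_mul, hK κ₁ hκ₁]
      _ = (m : ℂ) * f.toFun x := by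
          rw [hx, Representation.SmoothInd.toFun_subgroup_mul, hτ, deltaChar_apply, NNReal.smul_def, Complex.real_smul]
          push_cast
          change ((Measure.modularCharacter b₁ : ℝ≥0) : ℂ) * _ = _
          ring
  -- (Q) `∫_G Ξ(y⁻¹) φ_f(y g) dν = C · m · q(g·f)`
  have hQ : ∀ (f : Representation.SmoothInd (cmBorelTriple L 2 v).P (Representation.twist
          (((Representation.trivial ℂ ↥(torusU (conjLocal L (IsCMField.complexConj L) v) (cmLocalForm L 2 v)) ℂ).twist
            (torusCharPair (conjLocal L (IsCMField.complexConj L) v) (cmLocalForm L 2 v) (cmLocalForm_eq_over L 2 v) 0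
              ((torusLocalComponent L (IsCMField.complexConj L) v ξ.η).comp
                  (quotConj (conjLocal L (IsCMField.complexConj L) v) (conjLocal_conjLocal_cm L v)) *
                halfModulusChar (UnitaryGroup.LocalRing L v))
              (torusLocalComponent L (IsCMField.complexConj L) v ξ.ψ))).comp (cmBorelTriple L 2 v).proj)
          (rootDeltaChar (cmBorelTriple L 2 v).P))) (g : ↥(unitaryGroupOfForm (conjLocal L (IsCMField.complexConj L) v) (cmLocalForm L 2 v))),
      ∫ y : ↥(unitaryGroupOfForm (conjLocal L (IsCMField.complexConj L) v) (cmLocalForm L 2 v)), ((Ξ (y⁻¹) : ℂˣ) : ℂ) * (KU : Set ↥(unitaryGroupOfForm (conjLocal L (IsCMField.complexConj L) v) (cmLocalForm L 2 v))).indicator f.toFun (y * g) ∂ν =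
        (C : ℂ) * ((m : ℂ) * q (cmPrincipalSeries L 2 v (torusCharPair (conjLocal L (IsCMField.complexConj L) v) (cmLocalForm L 2 v) (cmLocalForm_eq_over L 2 v) 0
                ((torusLocalComponent L (IsCMField.complexConj L) v ξ.η).comp
                    (quotConj (conjLocal L (IsCMField.complexConj L) v) (conjLocal_conjLocal_cm L v)) *
                  halfModulusChar (UnitaryGroup.LocalRing L v))
                (torusLocalComponent L (IsCMField.complexConj L) v ξ.ψ)) g f)) := by
    intro f g
    -- continuity and compact support of the integrand
    have hcont : Continuous fun y : ↥(unitaryGroupOfForm (conjLocal L (IsCMField.complexConj L) v) (cmLocalForm L 2 v)) => ((Ξ (y⁻¹) : ℂˣ) : ℂ) * (KU : Set ↥(unitaryGroupOfForm (conjLocal L (IsCMField.complexConj L) v) (cmLocalForm L 2 v))).indicator f.toFun (y * g) :=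
      (hΞc.comp continuous_inv).mul ((hφlc f).continuous.comp (continuous_id.mul continuous_const))
    have hsupp : HasCompactSupport fun y : ↥(unitaryGroupOfForm (conjLocal L (IsCMField.complexConj L) v) (cmLocalForm L 2 v)) => ((Ξ (y⁻¹) : ℂˣ) : ℂ) * (KU : Set ↥(unitaryGroupOfForm (conjLocal L (IsCMField.complexConj L) v) (cmLocalForm L 2 v))).indicator f.toFun (y * g) := by
      refine HasCompactSupport.intro (hKc.image (continuous_id.mul continuous_const : Continuous fun y : ↥(unitaryGroupOfForm (conjLocal L (IsCMField.complexConj L) v) (cmLocalForm L 2 v)) => y * g⁻¹)) fun y hy => ?_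
      have hyg : y * g ∉ (KU : Set ↥(unitaryGroupOfForm (conjLocal L (IsCMField.complexConj L) v) (cmLocalForm L 2 v))) := fun h => hy ⟨y * g, h, by simp⟩
      rw [Set.indicator_of_notMem hyg, mul_zero]
    rw [hform _ hcont hsupp]
    push_cast
    congr 1
    rw [hq, ← integral_const_mul]
    refine integral_congr_ae (Filter.Eventually.of_forall fun k => ?_)
    change ∫ b : ↥(cmBorelTriple L 2 v).P, ((Ξ (((b : ↥(unitaryGroupOfForm (conjLocal L (IsCMField.complexConj L) v) (cmLocalForm L 2 v))) * (k : ↥(unitaryGroupOfForm (conjLocal L (IsCMField.complexConj L) v) (cmLocalForm L 2 v))))⁻¹) : ℂˣ) : ℂ) * (KU : Set ↥(unitaryGroupOfForm (conjLocal L (IsCMField.complexConj L) v) (cmLocalForm L 2 v))).indicator f.toFun ((b : ↥(unitaryGroupOfForm (conjLocal L (IsCMField.complexConj L) v) (cmLocalForm L 2 v))) * (k : ↥(unitaryGroupOfForm (conjLocal L (IsCMField.complexConj L) v) (cmLocalForm L 2 v))) * g) ∂μB =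
      (m : ℂ) * (((Ξ ((k : ↥(unitaryGroupOfForm (conjLocal L (IsCMField.complexConj L) v) (cmLocalForm L 2 v)))⁻¹) : ℂˣ) : ℂ) * (cmPrincipalSeries L 2 v (torusCharPair (conjLocal L (IsCMField.complexConj L) v) (cmLocalForm L 2 v) (cmLocalForm_eq_over L 2 v) 0
                ((torusLocalComponent L (IsCMField.complexConj L) v ξ.η).comp
                    (quotConj (conjLocal L (IsCMField.complexConj L) v) (conjLocal_conjLocal_cm L v)) *
                  halfModulusChar (UnitaryGroup.LocalRing L v))
                (torusLocalComponent L (IsCMField.complexConj L) v ξ.ψ)) g f).toFun k)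
    have e2 : ∀ b : ↥(cmBorelTriple L 2 v).P, ((Ξ (((b : ↥(unitaryGroupOfForm (conjLocal L (IsCMField.complexConj L) v) (cmLocalForm L 2 v))) * (k : ↥(unitaryGroupOfForm (conjLocal L (IsCMField.complexConj L) v) (cmLocalForm L 2 v))))⁻¹) : ℂˣ) : ℂ) * (KU : Set ↥(unitaryGroupOfForm (conjLocal L (IsCMField.complexConj L) v) (cmLocalForm L 2 v))).indicator f.toFun ((b : ↥(unitaryGroupOfForm (conjLocal L (IsCMField.complexConj L) v) (cmLocalForm L 2 v))) * (k : ↥(unitaryGroupOfForm (conjLocal L (IsCMField.complexConj L) v) (cmLocalForm L 2 v))) * g) =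
        ((Ξ ((k : ↥(unitaryGroupOfForm (conjLocal L (IsCMField.complexConj L) v) (cmLocalForm L 2 v)))⁻¹) : ℂˣ) : ℂ) * (((Ξ ((b : ↥(unitaryGroupOfForm (conjLocal L (IsCMField.complexConj L) v) (cmLocalForm L 2 v)))⁻¹) : ℂˣ) : ℂ) * (KU : Set ↥(unitaryGroupOfForm (conjLocal L (IsCMField.complexConj L) v) (cmLocalForm L 2 v))).indicator f.toFun ((b : ↥(unitaryGroupOfForm (conjLocal L (IsCMField.complexConj L) v) (cmLocalForm L 2 v))) * ((k : ↥(unitaryGroupOfForm (conjLocal L (IsCMField.complexConj L) v) (cmLocalForm L 2 v))) * g))) := by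
      intro b; rw [mul_inv_rev, map_mul, Units.val_mul, mul_assoc, mul_assoc]
    rw [show (fun b : ↥(cmBorelTriple L 2 v).P => ((Ξ (((b : ↥(unitaryGroupOfForm (conjLocal L (IsCMField.complexConj L) v) (cmLocalForm L 2 v))) * (k : ↥(unitaryGroupOfForm (conjLocal L (IsCMField.complexConj L) v) (cmLocalForm L 2 v))))⁻¹) : ℂˣ) : ℂ) * (KU : Set ↥(unitaryGroupOfForm (conjLocal L (IsCMField.complexConj L) v) (cmLocalForm L 2 v))).indicator f.toFun ((b : ↥(unitaryGroupOfForm (conjLocal L (IsCMField.complexConj L) v) (cmLocalForm L 2 v))) * (k : ↥(unitaryGroupOfForm (conjLocal L (IsCMField.complexConj L) v) (cmLocalForm L 2 v))) * g)) =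
        fun b : ↥(cmBorelTriple L 2 v).P => ((Ξ ((k : ↥(unitaryGroupOfForm (conjLocal L (IsCMField.complexConj L) v) (cmLocalForm L 2 v)))⁻¹) : ℂˣ) : ℂ) * (((Ξ ((b : ↥(unitaryGroupOfForm (conjLocal L (IsCMField.complexConj L) v) (cmLocalForm L 2 v)))⁻¹) : ℂˣ) : ℂ) * (KU : Set ↥(unitaryGroupOfForm (conjLocal L (IsCMField.complexConj L) v) (cmLocalForm L 2 v))).indicator f.toFun ((b : ↥(unitaryGroupOfForm (conjLocal L (IsCMField.complexConj L) v) (cmLocalForm L 2 v))) * ((k : ↥(unitaryGroupOfForm (conjLocal L (IsCMField.complexConj L) v) (cmLocalForm L 2 v))) * g))) from funext e2,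
      integral_const_mul, hP f ((k : ↥(unitaryGroupOfForm (conjLocal L (IsCMField.complexConj L) v) (cmLocalForm L 2 v))) * g)]
    change _ = (m : ℂ) * (((Ξ ((k : ↥(unitaryGroupOfForm (conjLocal L (IsCMField.complexConj L) v) (cmLocalForm L 2 v)))⁻¹) : ℂˣ) : ℂ) * f.toFun ((k : ↥(unitaryGroupOfForm (conjLocal L (IsCMField.complexConj L) v) (cmLocalForm L 2 v))) * g))
    ring
  -- (R) right translation: `∫_G Ξ(y⁻¹) φ_f(y g) dν = Ξ(g) ∫_G Ξ(y⁻¹) φ_f(y) dν`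
  have hR : ∀ (f : Representation.SmoothInd (cmBorelTriple L 2 v).P (Representation.twist
          (((Representation.trivial ℂ ↥(torusU (conjLocal L (IsCMField.complexConj L) v) (cmLocalForm L 2 v)) ℂ).twist
            (torusCharPair (conjLocal L (IsCMField.complexConj L) v) (cmLocalForm L 2 v) (cmLocalForm_eq_over L 2 v) 0
              ((torusLocalComponent L (IsCMField.complexConj L) v ξ.η).comp
                  (quotConj (conjLocal L (IsCMField.complexConj L) v) (conjLocal_conjLocal_cm L v)) *
                halfModulusChar (UnitaryGroup.LocalRing L v))
              (torusLocalComponent L (IsCMField.complexConj L) v ξ.ψ))).comp (cmBorelTriple L 2 v).proj)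
          (rootDeltaChar (cmBorelTriple L 2 v).P))) (g : ↥(unitaryGroupOfForm (conjLocal L (IsCMField.complexConj L) v) (cmLocalForm L 2 v))),
      ∫ y : ↥(unitaryGroupOfForm (conjLocal L (IsCMField.complexConj L) v) (cmLocalForm L 2 v)), ((Ξ (y⁻¹) : ℂˣ) : ℂ) * (KU : Set ↥(unitaryGroupOfForm (conjLocal L (IsCMField.complexConj L) v) (cmLocalForm L 2 v))).indicator f.toFun (y * g) ∂ν =
        ((Ξ g : ℂˣ) : ℂ) * ∫ y : ↥(unitaryGroupOfForm (conjLocal L (IsCMField.complexConj L) v) (cmLocalForm L 2 v)), ((Ξ (y⁻¹) : ℂˣ) : ℂ) * (KU : Set ↥(unitaryGroupOfForm (conjLocal L (IsCMField.complexConj L) v) (cmLocalForm L 2 v))).indicator f.toFun (y * 1) ∂ν := by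
    intro f g
    -- `G₂` is unimodular: `ν` is right invariant (the instance is introduced HERE ONLY: as an ambient local instance it derails the
    -- `IsHaarMeasure` searches of the integration formula)
    have hmod : ∀ g : ↥(unitaryGroupOfForm (conjLocal L (IsCMField.complexConj L) v) (cmLocalForm L 2 v)), Measure.modularCharacter g = 1 :=
      fun g => modularCharacter_local_eq_one_of_isotropic L (N := 2) (by norm_num) _ (antidiagOne_isHermitian L 2)
        (isUnit_antidiagOne_det L 2).ne_zero (antidiagOne_isotropic L (N := 2) (by norm_num)) v g
    haveI : ν.IsMulRightInvariant := isMulRightInvariant_of_modularCharacterFun_eq_one hmod ν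
    have e3 : ∀ y : ↥(unitaryGroupOfForm (conjLocal L (IsCMField.complexConj L) v) (cmLocalForm L 2 v)), ((Ξ (y⁻¹) : ℂˣ) : ℂ) * (KU : Set ↥(unitaryGroupOfForm (conjLocal L (IsCMField.complexConj L) v) (cmLocalForm L 2 v))).indicator f.toFun (y * g) =
        (fun y' : ↥(unitaryGroupOfForm (conjLocal L (IsCMField.complexConj L) v) (cmLocalForm L 2 v)) => ((Ξ g : ℂˣ) : ℂ) * (((Ξ (y'⁻¹) : ℂˣ) : ℂ) * (KU : Set ↥(unitaryGroupOfForm (conjLocal L (IsCMField.complexConj L) v) (cmLocalForm L 2 v))).indicator f.toFun (y' * 1))) (y * g) := by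
      intro y
      simp only [mul_one]
      rw [mul_inv_rev, map_mul, Units.val_mul, ← mul_assoc, ← mul_assoc, ← Units.val_mul, ← map_mul, mul_inv_cancel, map_one, Units.val_one, one_mul]
    have hνg : ν.map (fun y : ↥(unitaryGroupOfForm (conjLocal L (IsCMField.complexConj L) v) (cmLocalForm L 2 v)) => y * g) = ν := MeasureTheory.map_mul_right_eq_self ν g
    have e4 : ∫ y : ↥(unitaryGroupOfForm (conjLocal L (IsCMField.complexConj L) v) (cmLocalForm L 2 v)), (fun y' : ↥(unitaryGroupOfForm (conjLocal L (IsCMField.complexConj L) v) (cmLocalForm L 2 v)) => ((Ξ g : ℂˣ) : ℂ) * (((Ξ (y'⁻¹) : ℂˣ) : ℂ) * (KU : Set ↥(unitaryGroupOfForm (conjLocal L (IsCMField.complexConj L) v) (cmLocalForm L 2 v))).indicator f.toFun (y' * 1))) (y * g) ∂ν =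
        ∫ y : ↥(unitaryGroupOfForm (conjLocal L (IsCMField.complexConj L) v) (cmLocalForm L 2 v)), (fun y' : ↥(unitaryGroupOfForm (conjLocal L (IsCMField.complexConj L) v) (cmLocalForm L 2 v)) => ((Ξ g : ℂˣ) : ℂ) * (((Ξ (y'⁻¹) : ℂˣ) : ℂ) * (KU : Set ↥(unitaryGroupOfForm (conjLocal L (IsCMField.complexConj L) v) (cmLocalForm L 2 v))).indicator f.toFun (y' * 1))) y
          ∂(ν.map (fun y : ↥(unitaryGroupOfForm (conjLocal L (IsCMField.complexConj L) v) (cmLocalForm L 2 v)) => y * g)) := by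
      rw [← Homeomorph.coe_mulRight, ← Homeomorph.toMeasurableEquiv_coe, integral_map_equiv]
      simp only [Homeomorph.toMeasurableEquiv_coe, Homeomorph.coe_mulRight]
    rw [show (fun y : ↥(unitaryGroupOfForm (conjLocal L (IsCMField.complexConj L) v) (cmLocalForm L 2 v)) => ((Ξ (y⁻¹) : ℂˣ) : ℂ) * (KU : Set ↥(unitaryGroupOfForm (conjLocal L (IsCMField.complexConj L) v) (cmLocalForm L 2 v))).indicator f.toFun (y * g)) =
        fun y => (fun y' : ↥(unitaryGroupOfForm (conjLocal L (IsCMField.complexConj L) v) (cmLocalForm L 2 v)) => ((Ξ g : ℂˣ) : ℂ) * (((Ξ (y'⁻¹) : ℂˣ) : ℂ) * (KU : Set ↥(unitaryGroupOfForm (conjLocal L (IsCMField.complexConj L) v) (cmLocalForm L 2 v))).indicator f.toFun (y' * 1))) (y * g) from funext e3,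
      e4, hνg]
    exact integral_const_mul _ _
  -- assembling
  have hm0 : (0 : ℝ) < m := by
    rw [hm, Measure.real]
    refine ENNReal.toReal_pos (ne_of_gt (IsOpen.measure_pos μB (hKo.preimage continuous_subtype_val) ⟨1, KU.one_mem⟩)) ?_
    exact ((hBcl.isClosedEmbedding_subtypeVal.isCompact_preimage hKc).measure_lt_top).ne
  refine ⟨q, ?_, fun g f => ?_⟩
  · -- `q(f₀) = μ(K_v) ≠ 0`
    obtain ⟨f₀, hf₀⟩ := exists_xiSpherical L v ξ Ξ hΞ hΞo KU hKc hKo hGK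
    refine ⟨f₀, ?_⟩
    have hval : ∀ k : ↥KU, ((Ξ ((k : ↥(unitaryGroupOfForm (conjLocal L (IsCMField.complexConj L) v) (cmLocalForm L 2 v)))⁻¹) : ℂˣ) : ℂ) * f₀.toFun k = 1 := by
      intro k
      have h1 := hf₀ 1 (k : ↥(unitaryGroupOfForm (conjLocal L (IsCMField.complexConj L) v) (cmLocalForm L 2 v))) k.2
      rw [Subgroup.coe_one, one_mul, map_one, map_one, Units.val_one, one_mul, one_mul] at h1
      rw [h1, ← Units.val_mul, ← map_mul, inv_mul_cancel, map_one, Units.val_one]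
    rw [hq, show (fun k : ↥KU => ((Ξ ((k : ↥(unitaryGroupOfForm (conjLocal L (IsCMField.complexConj L) v) (cmLocalForm L 2 v)))⁻¹) : ℂˣ) : ℂ) * f₀.toFun k) = fun _ => (1 : ℂ) from funext hval, integral_const, Complex.real_smul, mul_one]
    have hpos : (0 : ℝ) < μK.real Set.univ := by
      rw [Measure.real]
      exact ENNReal.toReal_pos (ne_of_gt (IsOpen.measure_pos μK isOpen_univ Set.univ_nonempty)) (measure_lt_top μK _).ne
    exact_mod_cast hpos.ne'
  · -- equivariance
    have key : (C : ℂ) * ((m : ℂ) * q (cmPrincipalSeries L 2 v (torusCharPair (conjLocal L (IsCMField.complexConj L) v) (cmLocalForm L 2 v) (cmLocalForm_eq_over L 2 v) 0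
                ((torusLocalComponent L (IsCMField.complexConj L) v ξ.η).comp
                    (quotConj (conjLocal L (IsCMField.complexConj L) v) (conjLocal_conjLocal_cm L v)) *
                  halfModulusChar (UnitaryGroup.LocalRing L v))
                (torusLocalComponent L (IsCMField.complexConj L) v ξ.ψ)) g f)) =
        ((Ξ g : ℂˣ) : ℂ) * ((C : ℂ) * ((m : ℂ) * q (cmPrincipalSeries L 2 v (torusCharPair (conjLocal L (IsCMField.complexConj L) v) (cmLocalForm L 2 v) (cmLocalForm_eq_over L 2 v) 0
                ((torusLocalComponent L (IsCMField.complexConj L) v ξ.η).comp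
                    (quotConj (conjLocal L (IsCMField.complexConj L) v) (conjLocal_conjLocal_cm L v)) *
                  halfModulusChar (UnitaryGroup.LocalRing L v))
                (torusLocalComponent L (IsCMField.complexConj L) v ξ.ψ)) 1 f))) := by
      rw [← hQ f g, hR f g, hQ f 1]
    rw [map_one, Module.End.one_apply] at key
    have hCm : (C : ℂ) * (m : ℂ) ≠ 0 := mul_ne_zero (by exact_mod_cast hC.ne') (by exact_mod_cast hm0.ne')
    have key' : ((C : ℂ) * (m : ℂ)) * q (cmPrincipalSeries L 2 v (torusCharPair (conjLocal L (IsCMField.complexConj L) v) (cmLocalForm L 2 v) (cmLocalForm_eq_over L 2 v) 0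
                ((torusLocalComponent L (IsCMField.complexConj L) v ξ.η).comp
                    (quotConj (conjLocal L (IsCMField.complexConj L) v) (conjLocal_conjLocal_cm L v)) *
                  halfModulusChar (UnitaryGroup.LocalRing L v))
                (torusLocalComponent L (IsCMField.complexConj L) v ξ.ψ)) g f) = ((C : ℂ) * (m : ℂ)) * (((Ξ g : ℂˣ) : ℂ) * q f) := by
      rw [mul_assoc, key]; ring
    exact mul_left_cancel₀ hCm key'


/-! ## §4 HEAD: the binder `hQ` (H4) of ★ `F0P3bU2PrincipalSeriesJHOfBricks.uTwoPrincipalSeriesJH_of_bricks`, VERBATIM -/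

set_option synthInstance.maxHeartbeats 400000 in
set_option maxHeartbeats 1600000 in
/-- **(H4) `ξ₂ = (η_v ψ_v) ∘ det` IS A QUOTIENT OF `i(χH₂)`** — the hypothesis `hQ` of ★ `uTwoPrincipalSeriesJH_of_bricks` verbatim: for every CM field `L`,
every finite place `v` of `L⁺` with `c • w = w` for all `w ∣ v` and every `ξ ∈ OneDimAutRepH L` there is a linear functional `q ≠ 0` on the normalized
principal series `i(χH₂)` of `U(Φ₂)(L⁺_v)` with `q(g·f) = η_v(det g) ψ_v(det g) · q(f)`.  Proof: §3 at `Ξ := (η_v ∘ det) · (ψ_v ∘ det)` (continuous: ★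
`continuous_torusLocalComponent`, ★ `continuous_localDet`; open kernel: `U(Φ₂)(L⁺_v)` is non-archimedean ★ `nonarchimedeanGroup_cmLocal` and ★
`isOpen_ker_of_continuous_unitsComplex`).
[cite: Rogawski1990, §12.1 case (1) pp. 171–172] [cite: Casselman1995, §3.1, Prop. 6.4.1] [cite: BernsteinZelevinsky1977, §2.3] [cite: BernsteinZelevinsky1976, Prop. 2.29 pp. 23–24] -/
theorem xi_quotient_functional :
    ∀ (L : Type) [Field L] [NumberField L] [IsCMField L] (v : HeightOneSpectrum (𝓞 ↥(maximalRealSubfield L))) (ξ : OneDimAutRepH L),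
      (∀ w : PlacesOver L v, IsCMField.complexConj L • w.1 = w.1) →
      haveI := locallyCompactSpace_cmBorelU L 2 v
      ∃ q : Representation.SmoothInd (cmBorelTriple L 2 v).P
          (Representation.twist
            (((Representation.trivial ℂ ↥(torusU (conjLocal L (IsCMField.complexConj L) v) (cmLocalForm L 2 v)) ℂ).twist
              (torusCharPair (conjLocal L (IsCMField.complexConj L) v) (cmLocalForm L 2 v) (cmLocalForm_eq_over L 2 v) 0
                ((torusLocalComponent L (IsCMField.complexConj L) v ξ.η).comp
                    (quotConj (conjLocal L (IsCMField.complexConj L) v) (conjLocal_conjLocal_cm L v)) *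
                  halfModulusChar (UnitaryGroup.LocalRing L v))
                (torusLocalComponent L (IsCMField.complexConj L) v ξ.ψ))).comp (cmBorelTriple L 2 v).proj)
            (rootDeltaChar (cmBorelTriple L 2 v).P)) →ₗ[ℂ] ℂ,
        (∃ f, q f ≠ 0) ∧
        ∀ (g : ↥(unitaryGroupOfForm (conjLocal L (IsCMField.complexConj L) v) (cmLocalForm L 2 v))) (f : _),
          q (cmPrincipalSeries L 2 v
              (torusCharPair (conjLocal L (IsCMField.complexConj L) v) (cmLocalForm L 2 v) (cmLocalForm_eq_over L 2 v) 0
                ((torusLocalComponent L (IsCMField.complexConj L) v ξ.η).comp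
                    (quotConj (conjLocal L (IsCMField.complexConj L) v) (conjLocal_conjLocal_cm L v)) *
                  halfModulusChar (UnitaryGroup.LocalRing L v))
                (torusLocalComponent L (IsCMField.complexConj L) v ξ.ψ)) g f) =
            ((torusLocalComponent L (IsCMField.complexConj L) v ξ.η (localDet (IsCMField.complexConj L) v (isUnit_antidiagOne_det L 2) g) *
                torusLocalComponent L (IsCMField.complexConj L) v ξ.ψ (localDet (IsCMField.complexConj L) v (isUnit_antidiagOne_det L 2) g) : ℂˣ) : ℂ) *
              q f := by
  intro L _ _ _ v ξ _
  haveI : NonarchimedeanGroup ↥(unitaryGroupOfForm (conjLocal L (IsCMField.complexConj L) v) (cmLocalForm L 2 v)) := nonarchimedeanGroup_cmLocal L 2 v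
  have hc : Continuous fun g : ↥(unitaryGroupOfForm (conjLocal L (IsCMField.complexConj L) v) (cmLocalForm L 2 v)) =>
      (((((torusLocalComponent L (IsCMField.complexConj L) v ξ.η).comp (localDet (IsCMField.complexConj L) v (isUnit_antidiagOne_det L 2))) *
          ((torusLocalComponent L (IsCMField.complexConj L) v ξ.ψ).comp (localDet (IsCMField.complexConj L) v (isUnit_antidiagOne_det L 2))) :
            ↥(unitaryGroupOfForm (conjLocal L (IsCMField.complexConj L) v) (cmLocalForm L 2 v)) →* ℂˣ) g : ℂˣ) : ℂ) := by
    simp only [MonoidHom.mul_apply, MonoidHom.coe_comp, Function.comp_apply, Units.val_mul]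
    exact ((continuous_torusLocalComponent L (IsCMField.complexConj L) (v := v) ξ.η).comp
        (continuous_localDet (IsCMField.complexConj L) v (isUnit_antidiagOne_det L 2))).mul
      ((continuous_torusLocalComponent L (IsCMField.complexConj L) (v := v) ξ.ψ).comp
        (continuous_localDet (IsCMField.complexConj L) v (isUnit_antidiagOne_det L 2)))
  exact exists_xiQuotient_of_char L v ξ
    (((torusLocalComponent L (IsCMField.complexConj L) v ξ.η).comp (localDet (IsCMField.complexConj L) v (isUnit_antidiagOne_det L 2))) *
      ((torusLocalComponent L (IsCMField.complexConj L) v ξ.ψ).comp (localDet (IsCMField.complexConj L) v (isUnit_antidiagOne_det L 2))))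
    (fun _ => rfl) hc (F0P3bHPrincipalSeriesJHOfUTwo.isOpen_ker_of_continuous_unitsComplex _ hc)

end Summit.HodgeConjecture.HodgeConjecture.Cruxes.H413.F0P3bU2XiQuotientFunctional

end
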